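import Summits.BirchSwinnertonDyer.Rank1Residual.ManinAdditive.HasseDepthDegreeLaws
import Summits.BirchSwinnertonDyer.Rank1Residual.ManinAdditive.ThetaBrandtDegreeLaws
import Literature.NumberTheory.EllipticCurves.AnalyticRank
import Literature.NumberTheory.EllipticCurves.MordellWeil
import Literature.NumberTheory.EllipticCurves.QuadraticTwist
import Summits.BirchSwinnertonDyer.Rank1Residual.ManinAdditive.AtkinLehnerDegreeLaws
import HarnessLib
import HarnessLib.Audit.Tags

/-!
# bsd-f2-manin · desc g24 — THE FROBENIUS PAIRING ON THE θ-BRANDT MODULE AND THE ODD-COORDINATE THEOREM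
(cell `bsd-f2-manin`, seat `desc` = descent / visibility lens, gen 24, MEMO-desc §49; SKETCH — candidate rows typed over
tree declarations, nothing asserted: every law is an `@[conjecture] def … : Prop`, the edges are proved).

Setting (desc §34/§35, es §57): `N = 4M`, `M` odd; the semistable fibre of `X₀(N)` over `𝒪_L` (`ϖ³ = 2`) has one
supersingular component `y(o)` per supported `O^×`-orbit `o` of lines in `(ℤ/M)²` (`O` = Hurwitz order, `O^×/±1 = A₄`):
TYPE 1 (`Stab = 1`, weight `w_o = 1`) and TYPE `C₂` («Gaussian points», `Stab = C₂`, `w_o = 2`, present iff `M` is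
Gaussian).  The optimal curve's newform cuts out a primitive `ℤ[ω]`-line `ℤ[ω]·m_E` in the θ-Brandt module `𝓜_θ(M)`
(E-desc-117, tree `ThetaBrandtDegreeLawAtFourPrime`), and desc THEOREM P + the dictionary (§49.2) give termwise
`deg φ̄_{y(o)} = 2^{a(E)}·3^{1−t(E)}·w_o·Nm(m_E(o))`.

NEW IN g24 (§49): (1) the ARITHMETIC FROBENIUS `σ ∈ Gal(𝔽̄₂/𝔽₂)` acts on the components by `o ↦ Π·o`, `Π = 1 + i`
(NOT an Atkin–Lehner involution: `w₄` acts trivially on components), with `deg φ̄_{σy} = deg φ̄_y`; its fixed TYPE-1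
components are the `𝔽₂`-rational type-1 supersingular points = orbits of eigenlines of the trace-0, norm-2 elements
`ν ∈ O` (`ν² = −2`), and there are NONE iff `x² ≡ −2 (mod M)` is insoluble iff `M` has a prime factor `≡ 5, 7 (mod 8)`.
(2) LEMMA G2⁺ (PROVED on paper, §49.3): for every odd prime `ℓ ∤ M`, every `f ∈ 𝓜_θ(M)` and every Gaussian point
`x_G`: `(T_ℓ f)(x_G) ∈ 2ℤ[ω]` — the right action of `V₄ = Q₈/±1` on `O^×\{Nrd = ℓ}` is free (the normaliser of `Q₈`
in `B^×` is `ℚ^×O^×⟨1+i⟩`, which has no element of odd prime norm) and each `V₄`-orbit contributes `2·(…)`.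
(3) ODD-COORDINATE THEOREM (paper, from (2) + Chebotarev in `GL₂(𝔽₂) = S₃`): if `E(ℚ)[2] = 0` the primitive
eigenvector `m_E` has a TYPE-1 coordinate `≢ 0 (mod 2ℤ[ω])`; census 1 726 / 1 726 non-family optimal curves (`M ≤ 1445`,
prime and composite), the 11 exceptions being exactly the `s² + 4` family.  (4) With the cell's paper framework (PROP S,
THM P, LEMMA D `3·ord₂ c_E + a = m_L + μ(f)`, es 57.B / 57.H) this yields `ord₂(c_E) = 0` for every optimal `E` with
`4 ∥ N`, `E(ℚ)[2] = 0` and (IV at 2, any Hasse depth — the frontier class R-IV′ included — or IV* of Hasse depth 1),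
WITHOUT the ČNS input E-imc-51; and `(m_L, μ) = (1, 1)` on IV*/`h = 1` (es 57.R(β) «(2,0)» refuted by mechanism, 255/255).
(5) E-facing laws with Cremona-wide falsifiers (`N < 5·10⁵`): E-desc-164 (below, 101 489 / 101 489), E-desc-164c
(84 887 / 84 887), E-desc-165 FPV (209 / 209 σ-fixed components), E-desc-167 (133 / 133).

Engines: `HOME/desc/g17/brandt_theta.py` 962b3ce26edd93a4 + `folder/nb/hdepth2.py` (depth / Frobenius / G2 driver; tables
`nb/HD2-primes.tsv` 84 prime levels 119 curves, `nb/HD2-comp.tsv` 408 composite levels 1 619 rows, 1 FAIL 1980d) and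
`folder/nb/scan164.py` over Cremona `allcurves/alldegphi` (`N < 5·10⁵`).  PARTITION 0 (no referee-desk number touched) ·
beyond-print theorem: YES on paper ((2), (3); (4) conditional on the cell's framework), NO in Lean · BSD is not proved by this.

TYPER NOTE (typer g21, T-desc-46).  SOURCE = HOME/desc/g24/lean/Sketch-desc-g24.lean sha16 cbcc36ce57f0bebe (303 l.; desc: rc 0·0·0·0; MEMO-desc §49,
pack HOME/desc/g24/{nb,lean}/ + SHA16.txt) VERBATIM but for three typer deltas: (i) namespace `…ManinAdditive.DescG24` → `…ManinAdditive.FrobeniusPairing`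
(named for the mathematics, not the seat); (ii) cite keys: `Serre1996` ADDED to references.bib (J.-P. Serre, «Two letters on quaternions and modular forms
(mod p)», Israel J. Math. 95 (1996) 281–299, doi:10.1007/BF02761043) and the malformed `[cite: arXiv:1611.05623, …]` → `[cite: KazalickiKohen2017, …]`
(Kazalicki–Kohen, Res. Math. Sci. 4 (2017), arXiv:1611.05623 — key already in references.bib); (iii) this note.  Imports (all landed, Theses-free closure,
10 Summits modules): `…ManinAdditive.HasseDepthDegreeLaws` (p747400/p749773), `…ManinAdditive.ThetaBrandtDegreeLaws`, `…ManinAdditive.AtkinLehnerDegreeLaws`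
(p749440), Literature `AnalyticRank` / `MordellWeil` / `QuadraticTwist`, HarnessLib(+Audit.Tags).  ROWS (desc's `@[conjecture]` tags, nothing asserted) incl.
**E-desc-164 / 164c / 165 (FPV) / 166 (= LEMMA G2⁺, proved on paper) / 167 / 168 (odd coordinate) / 170 / 173 (Gross −8 / −4 vanishing laws) / 172 (quaternionic
Watkins)** and the PROVED edges of the sketch (15 declarations).  REFUTER: ref1/ref2 R-desc-40 PENDING at landing.  Decl names fresh; no instances, no
notation, no sorry.  `--supports` refused for ManinAdditive ⇒ bears_on: stmt-BirchSwinnertonDyer-22967 (C2 `ManinOddAtFour`).  BSD is not proved by this;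
C2 OPEN.
-/

set_option autoImplicit false

noncomputable section

open scoped MatrixGroups ModularForm

open CongruenceSubgroup WeierstrassCurve Literature.NumberTheory.EllipticCurves.ModularForms
open Summit.BirchSwinnertonDyer.Rank1Residual.ManinAdditive.ConwayCut
open Summit.BirchSwinnertonDyer.Rank1Residual.ManinAdditive.JumpDegree
open Summit.BirchSwinnertonDyer.Rank1Residual.ManinAdditive.TameTwoLocal
open Summit.BirchSwinnertonDyer.Rank1Residual.ManinAdditive.HasseDepth
open Summit.BirchSwinnertonDyer.Rank1Residual.ManinAdditive.HurwitzBrandt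
open Summit.BirchSwinnertonDyer.Rank1Residual.ManinAdditive.ThetaBrandt

namespace Summit.BirchSwinnertonDyer.Rank1Residual.ManinAdditive.FrobeniusPairing

/-! ### §1. The E-blind level predicate «Frobenius acts freely on the type-1 supersingular points» -/

/-- `x² ≡ −2 (mod M)` is insoluble for `M = N/4`: some prime factor `q` of `N` is `≡ 5` or `≡ 7 (mod 8)` (i.e.
`(−2/q) = −1`; for `4 ∥ N` equivalently: the arithmetic Frobenius `σ` of `𝔽̄₂/𝔽₂` has NO fixed point among the type-1
supersingular points of `X₀(N/4)_{𝔽̄₂}` — desc g24 FROBENIUS PAIRING THEOREM, MEMO-desc §49.3). [folklore] -/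
def HasPrimeFactorFiveOrSevenModEight (N : ℕ) : Prop :=
  ∃ q : ℕ, q.Prime ∧ q ∣ N ∧ (q % 8 = 5 ∨ q % 8 = 7)

/-- At a prime level `N = 4p` (`p` an odd prime) the predicate reads `p ≡ 5, 7 (mod 8)`. -/
theorem hasPrimeFactorFiveOrSevenModEight_four_mul_prime_iff {p : ℕ} (hp : p.Prime) (hp2 : p ≠ 2) :
    HasPrimeFactorFiveOrSevenModEight (4 * p) ↔ (p % 8 = 5 ∨ p % 8 = 7) := by
  constructor
  · rintro ⟨q, hq, hqN, h57⟩
    have hq2 : q ≠ 2 := by rintro rfl; omega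
    rcases (Nat.Prime.dvd_mul hq).mp hqN with h4 | hqp
    · exfalso
      have h22 : q ∣ 2 ^ 2 := by simpa using h4
      have := (Nat.prime_dvd_prime_iff_eq hq Nat.prime_two).mp (hq.dvd_of_dvd_pow h22)
      exact hq2 this
    · have := (Nat.prime_dvd_prime_iff_eq hq hp).mp hqp
      subst this
      exact h57
  · intro h
    exact ⟨p, hp, Dvd.intro_left 4 rfl, h⟩

/-- … equivalently `−2` is NOT a square mod `p` (second supplement to quadratic reciprocity, Mathlib
`ZMod.exists_sq_eq_neg_two_iff`). -/
theorem hasPrimeFactorFiveOrSevenModEight_four_mul_prime_iff_not_isSquare {p : ℕ} [Fact p.Prime] (hp2 : p ≠ 2) :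
    HasPrimeFactorFiveOrSevenModEight (4 * p) ↔ ¬ IsSquare (-2 : ZMod p) := by
  have hp : p.Prime := Fact.out
  rw [hasPrimeFactorFiveOrSevenModEight_four_mul_prime_iff hp hp2, ZMod.exists_sq_eq_neg_two_iff hp2]
  have h₁ := (Nat.Prime.mod_two_eq_one_iff_ne_two hp).mpr hp2
  omega

/-! ### §2. The Frobenius-pairing degree laws (E-facing, any parametrisation at the conductor level) -/

/-- **Row E-desc-164 `FrobeniusPairingFourDividesDegree`** (LAW with a paper proof modulo the cell's framework; desc g24,
MEMO-desc §49.3; nothing asserted).  `4 ∥ N`, Kodaira IV* at `2`, `N` has a prime factor `≡ 3 (mod 4)` (non-Gaussian level: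
no `C₂` components, desc THEOREM J) AND a prime factor `≡ 5, 7 (mod 8)` (`σ` acts freely on the type-1 components)
⟹ `4 ∣ deg φ` for EVERY modular parametrisation `X₀(N) → E` — any torsion, any rank, optimal or not.
Census (Cremona `N < 5·10⁵`, `folder/nb/scan164.py`): 101 489 / 101 489 IV* curves on such levels (65 072 optimal), 0
exceptions; on the complementary IV* levels `deg φ ≡ 2 (mod 4)` occurs (44a1 `2`, 76a1 `6`, 108a1 `6`, 172a1 `12`·, 268a1 `18`).
Mechanism (paper): `deg φ = Σ_y deg φ̄_y` over the type-1 components (THM P (c), `n₂ = 0` by THM J), each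
`deg φ̄_y = 2·3^{1−t}·Nm(m_E(o))` (IV*, `E(ℚ)[2] = 0`; with rational 2-torsion the optimal curve is in the `s² + 4` family,
impossible at a non-Gaussian level, and `deg` of a non-optimal curve is a multiple), and the free involution `y ↦ σy`
preserves `deg φ̄_y`, so the sum is `2·(even)`.  Why it might fail: a IV* curve whose θ-eigenline is NOT defined over
`ℤ[ω]` with `σ` acting through `Π` as computed (a failure of the JL-identification CLAIM behind E-desc-117 at some composite
level), or a non-optimal curve of odd isogeny degree from an optimal one outside the class — none below `5·10⁵`.
[cite: CalegariEmerton2009, Thm. 1.1 (arXiv:math/0503359 p. 2: `E[2]` irreducible (+ hypotheses at 2) ⇒ `deg φ` even — the parity floor; the mod-4 law keyed to `(−2/q)` is the cell's E-desc-164, NOT in print)]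
[cite: Watkins2002, §4 p. 12 (doi:10.1080/10586458.2002.10504701: powers of 2 in the modular degree «as might be suggested from an analysis of Atkin–Lehner involutions» — heuristic; here the involution is the arithmetic Frobenius on the supersingular fibre, not Atkin–Lehner)] -/
@[conjecture]
def FrobeniusPairingFourDividesDegree : Prop :=
  ∀ (W : WeierstrassCurve ℚ) [W.IsElliptic] [W.IsGloballyMinimal] [NeZero (W.conductorNorm ℤ)]
    (D : ModularParametrizationData W (W.conductorNorm ℤ)),
    IsTypeFourStarAtTwoTame W → HasPrimeFactorThreeModFour (W.conductorNorm ℤ) →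
      HasPrimeFactorFiveOrSevenModEight (W.conductorNorm ℤ) → 4 ∣ D.modularDegree

/-- **Row E-desc-164c `FrobeniusPairingEvenDegreeOfTypeFour`** (LAW, same mechanism one step down; nothing asserted).
`4 ∥ N`, Kodaira IV at `2` (`v₂(Δ) = 4`), `N` non-Gaussian with a prime factor `≡ 5, 7 (mod 8)` ⟹ `deg φ` is EVEN (here
`deg φ̄_y = 3^{1−t}·Nm(m_E(o))` and the free `σ`-pairing makes the number of odd terms even).  Census: 84 887 / 84 887 IV
curves on such levels (`N < 5·10⁵`), 0 exceptions; IV curves of odd degree exist elsewhere (36a1 `1`).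
[cite: CalegariEmerton2009, Thm. 1.1 (arXiv:math/0503359 p. 2: parity for `E[2]` irreducible; E-desc-164c also covers the reducible IV curves on these levels — the cell's, NOT in print)] -/
@[conjecture]
def FrobeniusPairingEvenDegreeOfTypeFour : Prop :=
  ∀ (W : WeierstrassCurve ℚ) [W.IsElliptic] [W.IsGloballyMinimal] [NeZero (W.conductorNorm ℤ)]
    (D : ModularParametrizationData W (W.conductorNorm ℤ)),
    padicValNat 2 (W.conductorNorm ℤ) = 2 → padicValRat 2 W.Δ = 4 → HasPrimeFactorThreeModFour (W.conductorNorm ℤ) →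
      HasPrimeFactorFiveOrSevenModEight (W.conductorNorm ℤ) → 2 ∣ D.modularDegree

open scoped Classical in
/-- **E-desc-167 (i) as an EDGE**: E-desc-164 + es's Gaussian law E-es-169 (tree `GaussianLevelFourDividesDegree`) give
«IV*, no rational 2-torsion, some prime factor `≡ 5, 7 (mod 8)` ⟹ `4 ∣ deg φ`» — contrapositively, `deg φ ≡ 2 (mod 4)` on a
torsion-free IV* curve FORCES every prime factor of `N/4` to be `≡ 1, 3 (mod 8)` (`x² ≡ −2 (mod N/4)` soluble: a `σ`-fixed
type-1 component exists).  Census of the conclusion: the 133 optimal IV* curves with `E(ℚ)[2] = 0` and `deg φ ≡ 2 (mod 4)`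
below `5·10⁵` all have `N/4` with prime factors `≡ 1, 3 (mod 8)` only AND `v₂(c₄) ≥ 5` (133 / 133; E-desc-167). -/
theorem four_dvd_modularDegree_of_fourStar_of_hasPrimeFactorFiveOrSevenModEight
    (h164 : FrobeniusPairingFourDividesDegree) (h169 : GaussianLevelFourDividesDegree)
    (W : WeierstrassCurve ℚ) [W.IsElliptic] [W.IsGloballyMinimal] [NeZero (W.conductorNorm ℤ)]
    (D : ModularParametrizationData W (W.conductorNorm ℤ))
    (hIV : IsTypeFourStarAtTwoTame W) (hT : ¬ HasRationalTwoTorsion W)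
    (h57 : HasPrimeFactorFiveOrSevenModEight (W.conductorNorm ℤ)) : 4 ∣ D.modularDegree := by
  by_cases h3 : HasPrimeFactorThreeModFour (W.conductorNorm ℤ)
  · exact h164 W D hIV h3 h57
  · exact h169 W D hIV.1 ((not_hasPrimeFactorThreeModFour_iff _).mp h3) hT

/-! ### §3. Engine-side statements at a PRIME level `M = p` (vocabulary of `ThetaBrandtDegreeLaws` §2: `g : ℙ¹(𝔽_p) → ℤ[ω]`
θ-equivariant, primitive, `W g` Hecke-eigen; `stabWeight p x = 1` = type 1, `= 2` = Gaussian point) -/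

/-- `Π = 1 + i` in doubled coordinates (`dnorm = 8 = 4·Nrd Π`); `O Π = 𝔓`, `Π² = 2i`; conjugation by `Π` normalises `O`
and induces on `O^×\ℙ¹(ℤ/M)` = {supersingular points of `X₀(M)_{𝔽̄₂}`} the ARITHMETIC FROBENIUS (desc g24 §49.3). [folklore] -/
def piDQuat : DQuat := (2, 2, 0, 0)

example : DQuat.dnorm piDQuat = 8 := by decide

/-- The point `x ∈ ℙ¹(𝔽_p)` is FROBENIUS-FIXED: `Π·x` lies in the `O^×`-orbit of `x` (its supersingular point is
`𝔽₂`-rational).  For a type-1 point this says `x` is an eigenline of some `ν ∈ O` with `ν² = −2`; such points exist iff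
`(−2/p) = 1`, and then form exactly ONE orbit at a prime level (`A₄` is simply transitive on the twelve `ν`). [folklore] -/
def IsFrobeniusFixed (p : ℕ) (x : Fin (p + 1)) : Prop :=
  ∃ u ∈ hurwitzUnits, act p piDQuat x = act p u x

/-- **Row E-desc-166 `HeckeVanishesAtGaussianPointsModTwo` — LEMMA G2⁺ (THEOREM ON PAPER, desc g24 §49.3; typed as a
conjecture def pending formalisation; E-blind).**  For every prime `p ≥ 5`, every odd prime `ℓ ≠ p`, every θ-equivariant
`f : ℙ¹(𝔽_p) → ℤ[ω]` and every Gaussian point `x` (`stabWeight p x = 2`): `(T_ℓ f)(x) ∈ 2ℤ[ω]`, i.e. `48 ∣ T₂₄,ℓ f (x)`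
coordinatewise (`T₂₄ = 24·T_ℓ` on θ-equivariant functions).  Proof: `V₄ = Q₈/±1` acts on the right cosets `O^×γ`,
`Nrd γ = ℓ`, by `γ ↦ γu⁻¹`, FREELY (a `V₄`-fixed coset would put `γ` in the normaliser `ℚ^×O^×⟨1+i⟩` of `Q₈`, which has
no element of odd prime norm); the unit of `Q₈` fixing the line `x` gives pairs of cosets with the same point `γx` and the
same phase, the other units pair `γx` with the second eigenline of `±γiγ⁻¹`, a unit translate with trivial phase; so every
`V₄`-orbit contributes `2·(…)`.  Census (engine `hdepth2.py`, column `G` of `T_ℓ` mod 2): 1 872 / 1 872 matrix entries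
zero over all Gaussian levels `M ≤ 1445` (prime and composite), `ℓ ≤ 41`.  Why it might fail: it cannot at prime level if
the proof is right; the typed form could fail only through a convention mismatch of `thetaHecke24` (phase `ω^{+θ̃(γ)}` vs
the engine's `θ̃(γ)⁻¹` — harmless for divisibility by 2).
[cite: Gross1987Heights, §1 (Brandt matrices at prime level and the adjointness `w_j B(i,j) = w_i B(j,i)` — the weight-2 / `C₂` points; the mod-2 vanishing is the cell's LEMMA G2⁺, NOT in print)] -/
@[conjecture]
def HeckeVanishesAtGaussianPointsModTwo : Prop :=
  ∀ (p : ℕ), p.Prime → 5 ≤ p → ∀ (ℓ : ℕ), ℓ.Prime → ℓ ≠ 2 → ℓ ≠ p →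
  ∀ f : Fin (p + 1) → ZOmega, IsThetaEquivariant p f →
  ∀ x : Fin (p + 1), stabWeight p x = 2 →
    (48 : ℤ) ∣ (thetaHecke24 p ℓ f x).1 ∧ (48 : ℤ) ∣ (thetaHecke24 p ℓ f x).2

/-- **Row E-desc-168 `OddTypeOneCoordinateAtFourPrime` — THE ODD-COORDINATE THEOREM at prime level (THEOREM ON PAPER for
`E(ℚ)[2] = 0`, desc g24 §49.3, from LEMMA G2⁺ + Chebotarev; typed as a conjecture def; nothing asserted).**  For a curve of
conductor `4p` WITHOUT a rational 2-torsion point, every primitive θ-equivariant Hecke eigenvector `g` has a TYPE-1 point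
`x` with `g(x) ∉ 2ℤ[ω]`.  (Else `ḡ ≠ 0` is supported on Gaussian points, `T_ℓ ḡ = 0` by G2⁺, so `a_ℓ(E)` is even for all odd
`ℓ ≠ p`, the image of `ρ̄_{E,2}` in `S₃` has no 3-cycle, and `E(ℚ)[2] ≠ 0`.)  Through the dictionary (§49.2) the point `x`
is a component `y` of the semistable fibre with `deg φ̄_y` odd (IV) resp. `≡ 2 (mod 4)` (IV*): `m_L = 0` (IV, es 57.B) resp.
`m_L = 1` (IV* of Hasse depth 1, es 57.H (ii)), whence `ord₂(c_E) = 0` by desc LEMMA D — MEMO-desc §49.4.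
Census (BC5 witness): prime levels `p ≤ 1429`: 108 / 108 curves with `E(ℚ)[2] = 0` (IV 49, IV* 59); all levels `M ≤ 1445`:
1 726 / 1 726 non-family optimal curves (IV 1 003 incl. 479 with rational 2-torsion, IV* 723); the 11 curves with every
type-1 coordinate even are exactly the `s² + 4` family (20a, 52a, 116c, 212b, 692a, 916a, 1172a, 2932a, 4372a, 4916a, 5492b).
Why it might fail: at prime level only through a failure of multiplicity one (E-desc-117's construction clause); the
unproved remainder of the all-level law is «IV with rational 2-torsion at a Gaussian level» (42 / 42).
[cite: Serre1972, §5.4 Prop. 21 p. 306 (doi:10.1007/BF01405086: Chebotarev reading of `ρ̄_{E,ℓ}` — image in `GL₂(𝔽₂) ≅ S₃` meets the 3-cycles iff some `a_ℓ` is odd iff `E(ℚ)[2] = 0` for the 2-division field; used verbatim in the paper proof)] -/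
@[conjecture]
def OddTypeOneCoordinateAtFourPrime : Prop :=
  ∀ (p : ℕ), p.Prime → 5 ≤ p →
  ∀ (W : WeierstrassCurve ℚ) [W.IsElliptic], W.conductorNorm ℤ = 4 * p → ¬ HasRationalTwoTorsion W →
  ∀ g : Fin (p + 1) → ZOmega,
    IsThetaEquivariant p g → IsPrimitive p g → IsThetaHeckeEigen p g (fun n => W.LFunction n) →
    ∃ x : Fin (p + 1), stabWeight p x = 1 ∧ ¬ ((2 : ℤ) ∣ (g x).1 ∧ (2 : ℤ) ∣ (g x).2)

/-- **Row E-desc-165 `HasseMinimalFrobeniusFixedVanishing` — FIXED-POINT VANISHING (FPV; LAW, desc g24 §49.3; nothing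
asserted).**  If the globally minimal model has `v₂(c₄) = 4` (Hasse depth `h(E)` minimal: `1` on IV*, `2` on IV; ⟺ the
canonical subgroup of `E/ℚ₂^{nr}(ϖ)` exists; on IV* ⟺ `E(ℚ₂)[2] ≠ 0`, es E-es-170) then the θ-eigenvector is EVEN at every
Frobenius-fixed type-1 point: `g(x) ∈ 2ℤ[ω]`.  Equivalently the component isogeny `φ̄_{y*} : E_{y*} → Ē` between the two
`𝔽₂`-RATIONAL curves has Hurwitz depth `≥ a(E) + 2`.  Structure behind it (Λ*-LEMMA, §49.3): `Hom_{𝔽₂}(E_{y*}, Ē)^{θ} = ℤ·x_min`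
(Skolem–Noether), `deg φ̄_{y*} = n²·Nrd(x_min)`, so FPV says `n` is even when `h(E)` is minimal.  Census: 209 / 209 σ-fixed
type-1 components of curves with `v₂(c₄) = 4` (IV* `h = 1`: 108, depths `3, 5, 7, ∞`, never `1`; IV `h = 2`: 101, depths
`2, 4, 6, ∞`, never `0`; prime levels: 15 / 15), against `v₂(c₄) ≥ 5`: odd `g(x*)` at 96 of 449 fixed components.
CONSEQUENCE: with the σ-pairing, FPV is the MECHANISM of es's law E-es-168 (`IV*`, local 2-torsion, no rational 2-torsion ⟹
`4 ∣ deg φ`, 37 466 / 37 466): the depth-1 type-1 components come in σ-pairs.  Why it might fail: a IV* curve with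
`E(ℚ₂)[2] ≠ 0` at a level with `(−2/q) = 1` for all `q ∣ M` whose eigenvector is odd at the `ν`-orbit — none in range; the
conceptual proof (mod-2 quaternionic forms à la Serre's letters: `ρ̄_{E,2}|G_{ℚ₂}` reducible ⟹ vanishing at `𝔽₂`-rational
supersingular points) is NOT written.  REFINED CENSUS (same tables): evenness at σ-fixed type-1 points holds for
EVERY curve with `E(ℚ)[2] = 0` except in the class IV* ∧ `v₂(c₄) ≥ 5` (2-division field totally ramified at 2):
IV irreducible 244 / 244 fixed components (any `c₄`), IV* `h = 1` 108 / 108, against IV* `h = 3`: 55 odd of 225 — and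
there ONLY at rank 0 (rank ≥ 1: 0 odd of 124), which is the Gross law E-desc-170 below.
[cite: Serre1996, pp. 281–299 (Israel J. Math. 95, «Two letters on quaternions and modular forms (mod p)»: mod-`p` forms as functions on the supersingular set with `O_D^×`-character — the dictionary in which FPV should be proved; the statement is the cell's, NOT in print)] -/
@[conjecture]
def HasseMinimalFrobeniusFixedVanishing : Prop :=
  ∀ (p : ℕ), p.Prime → 5 ≤ p →
  ∀ (W : WeierstrassCurve ℚ) [W.IsElliptic] [W.IsGloballyMinimal], W.conductorNorm ℤ = 4 * p →
    padicValRat 2 W.c₄ = 4 →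
  ∀ g : Fin (p + 1) → ZOmega,
    IsThetaEquivariant p g → IsPrimitive p g → IsThetaHeckeEigen p g (fun n => W.LFunction n) →
  ∀ x : Fin (p + 1), stabWeight p x = 1 → IsFrobeniusFixed p x → (2 : ℤ) ∣ (g x).1 ∧ (2 : ℤ) ∣ (g x).2

/-! ## §5 Gross periods of discriminant `−8` and `−4` on the θ-Brandt module; the quaternionic Watkins inequality (desc g24 §49.3b)

The σ-fixed type-1 orbits at level `M` are exactly the optimal embeddings of `ℤ[√−2]` into the level-`M` Hurwitz orders
(eigenlines of the twelve `ν ∈ O`, `ν² = −2`), i.e. Gross's special cycle of discriminant `−8`; the Gaussian points are the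
cycle of discriminant `−4`.  The laws below say that the θ-eigenvector RESTRICTED TO SUCH A CYCLE vanishes identically iff
`L(E,1)·L(E ⊗ χ_D, 1) = 0` — the non-vanishing half of a Gross–Waldspurger period formula at the jointly ramified prime `2`
(algebra, form AND CM field all ramified at `2`), with the numerically exact prime-level identity
`L_alg(E)·L_alg(E^{(D)}) = 2^{−e}·3^{−f}·Nm(g(x_D))` recorded in MEMO-desc §49.3b (D = −8: 12 / 12; D = −4: 23 / 23).
Nearest print: Gross 1987 (prime level, maximal orders) [cite: Gross1987Heights, §11–13]; Kazalicki–Kohen 2016 Conj. 1 /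
Thm. 2 (rank > 0 ⟹ quaternionic eigenvector even at `𝔽_p`-rational supersingular points, prime conductor)
[cite: KazalickiKohen2017, arXiv:1611.05623, Conj. 1 and Thm. 2 p. 4]. -/

/-- **Row E-desc-170 `GrossMinusEightVanishingAtFourPrime`** (LAW, desc g24 §49.3b; nothing asserted).  At a prime level
`p ≡ 1, 3 (mod 8)` (so that one σ-fixed type-1 orbit exists) the primitive θ-eigenvector of an optimal `E` of conductor
`4p` vanishes at the σ-fixed type-1 points iff `L(E,1)·L(E^{(−8)},1) = 0` (analytic ranks; `E^{(−8)} = E^{(−2)}` =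
`W.quadraticTwist (-2)`).  Census (all levels `M ≤ 1445` with `(−2/q) = 1 ∀ q ∣ M`, «all fixed coordinates zero» against
Cremona ranks of `E` and `E^{(−8)}`): 342 / 342 curves (irreducible 303: 212 vanishing ↔ `LL = 0`, 91 non-zero ↔ `LL ≠ 0`;
with rational 2-torsion 39: 7 / 32); prime-level exact identity `L_alg(E)L_alg(E^{(−8)}) = R·Nm(g x*)`, `R ∈ {1, ½, ⅓, ⅙}`
by class (IV* `h=3`, `#E(ℚ)_tors = 1`: `R = 1`, 6 / 6), 12 / 12, and `0 = 0` on the 38 vanishing ones.  Why it might fail: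
a local Tunnell–Saito sign making the `B_{2,∞}`-period the wrong one for some residue class of `p`, or a rank-0 pair with
an accidentally vanishing period at a composite level (cancellation between several fixed orbits is excluded from this
prime-level form).  [cite: Gross1987Heights, Prop. 11.2–11.3 and §13 (the prime-level special value formula this transplants to level `4p` with the θ-type at 2)] -/
@[conjecture]
def GrossMinusEightVanishingAtFourPrime : Prop :=
  ∀ (p : ℕ), p.Prime → 5 ≤ p → IsSquare (-2 : ZMod p) →
  ∀ (W : WeierstrassCurve ℚ) [W.IsElliptic], W.conductorNorm ℤ = 4 * p →
  ∀ g : Fin (p + 1) → ZOmega,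
    IsThetaEquivariant p g → IsPrimitive p g → IsThetaHeckeEigen p g (fun n => W.LFunction n) →
  ((∀ x : Fin (p + 1), stabWeight p x = 1 → IsFrobeniusFixed p x → g x = 0) ↔
    (1 ≤ W.analyticRank ∨ 1 ≤ (W.quadraticTwist (-2)).analyticRank))

/-- **Row E-desc-173 `GrossMinusFourVanishingAtFourPrime`** (LAW, desc g24 §49.3b; nothing asserted).  The `D = −4`
companion: at a Gaussian prime level `p ≡ 1 (mod 4)` the θ-eigenvector vanishes at the Gaussian points (stabiliser weight 2)
iff `L(E,1)·L(E^{(−4)},1) = 0` (`E^{(−4)} = E^{(−1)}`).  Census (all Gaussian levels `M ≤ 1445`, every optimal curve incl.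
2-torsion and the `s²+4` family): 170 / 170 (104 vanishing ↔ `LL = 0`; 66 non-zero ↔ `LL ≠ 0`, among them the 11 family
curves); prime-level exact identity `L_alg(E)L_alg(E^{(−4)}) = R·Nm(g x_G)`, `R ∈ {1, ¼, ⅓, ⅙, 1/12}` by class (IV*
irreducible, `#E(ℚ)_tors = 1`: `R = 1`, 7 / 7), 23 / 23.  Why it might fail: as E-desc-170.
[cite: Gross1987Heights, Prop. 11.2–11.3 and §13] -/
@[conjecture]
def GrossMinusFourVanishingAtFourPrime : Prop :=
  ∀ (p : ℕ), p.Prime → 5 ≤ p → p % 4 = 1 →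
  ∀ (W : WeierstrassCurve ℚ) [W.IsElliptic], W.conductorNorm ℤ = 4 * p →
  ∀ g : Fin (p + 1) → ZOmega,
    IsThetaEquivariant p g → IsPrimitive p g → IsThetaHeckeEigen p g (fun n => W.LFunction n) →
  ((∀ x : Fin (p + 1), stabWeight p x = 2 → g x = 0) ↔
    (1 ≤ W.analyticRank ∨ 1 ≤ (W.quadraticTwist (-1)).analyticRank))

/-- **E-desc-171 «Watkins + 1» is NOT a new row** (desc g24 §49.3b, corrected at close-out): «IV*, `E(ℚ)[2] = 0` ⟹
`2^{rank+1} ∣ deg φ`» (Cremona-wide 87 106 / 87 106, sharp in every rank at `ω(N) = 2`) is IMPLIED by es's landed law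
E-es-172 `AtkinLehnerDegree.FourStarRefinedWatkins` («`2^{ω(N)−1+R} ∣ deg φ`», same habitat, same census), which is
sharper at composite levels.  What desc adds is the prime-level quaternionic SOURCE (E-desc-172: `v₂⟨g,g⟩_θ ≥ R`) and its
Gross-period mechanism (E-desc-170), plus the dictionary reason why the refined form fails on IV (there `a = 0`: the
Atkin–Lehner `2` and the rank `2` are the same `2 = v₂⟨g,g⟩`).  Edge PROVED: E-es-172 ∧ `ω(N) ≥ 2` ⊢ Watkins + 1. -/
theorem two_pow_rank_succ_dvd_modularDegree_of_refinedWatkins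
    (h172 : AtkinLehnerDegree.FourStarRefinedWatkins)
    (W : WeierstrassCurve ℚ) [W.IsElliptic] [W.IsGloballyMinimal] {N : ℕ} [NeZero N]
    (D : ModularParametrizationData W N) (hN : W.conductorNorm ℤ = N)
    (hIV : IsTypeFourStarAtTwoTame W) (hT : ¬ HasRationalTwoTorsion W) (hω : 2 ≤ N.primeFactors.card) :
    2 ^ (W.mordellWeilRank + 1) ∣ D.modularDegree :=
  (pow_dvd_pow 2 (by omega)).trans (h172 W D hN hIV hT)

/-- **Row E-desc-172 `ThetaHeightTwoAdicWatkinsAtFourPrime`** (LAW, desc g24 §49.3b; nothing asserted).  The quaternionic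
Watkins inequality behind E-desc-171, uniformly over the whole tame cell at prime level: `v₂⟨g,g⟩_θ ≥ rank E(ℚ)` for the
primitive θ-eigenvector (`thetaHeightTwelve = 12·⟨g,g⟩`).  Through E-desc-117 (`deg φ = 2^{a}3^{1−t}⟨g,g⟩`) its E-facing
shadow is: IV* irreducible `2^{r+1} ∣ deg φ` (= es's landed E-es-172 `FourStarRefinedWatkins` at `ω(N) = 2`, 87 106 /
87 106), IV and IV-with-2-torsion `2^{r} ∣ deg φ` (Watkins; 0 exceptions
among 89 369 optimal and 7 100 non-optimal IV curves `< 5·10⁵`, equality 413 + 5 times), family `2^{r−1} ∣ deg φ`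
(the 55 odd-degree family curves).  Why it might fail: a IV* curve of rank `R ≥ 2` at a prime level `4p` with `v₂(deg φ) = R` (none below `5·10⁵`).
[cite: Watkins2002, Conj. 4.1 p. 12; Gross1987Heights, §1] -/
@[conjecture]
def ThetaHeightTwoAdicWatkinsAtFourPrime : Prop :=
  ∀ (p : ℕ), p.Prime → 5 ≤ p →
  ∀ (W : WeierstrassCurve ℚ) [W.IsElliptic], W.conductorNorm ℤ = 4 * p →
  ∀ g : Fin (p + 1) → ZOmega,
    IsThetaEquivariant p g → IsPrimitive p g → IsThetaHeckeEigen p g (fun n => W.LFunction n) →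
    (12 * 2 ^ W.mordellWeilRank : ℤ) ∣ thetaHeightTwelve p g

end Summit.BirchSwinnertonDyer.Rank1Residual.ManinAdditive.FrobeniusPairing
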